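import Summits.AtomisticToContinuum.Crystallization.Theorems.IsometryAtomsAtomicLawChargesCrystalFiniteOrbitsB

/-!
# Rooted isometry classes: the detailed Mecke balance between two class events

Helper file C of stub `stub_finiteOrbitsOfChargedClass` (line `Sketch`, crux `AtomicLawChargesCrystal`,
stmt-AtomisticToContinuum-15778) — the route's Palm lever in its DETAILED (two-event) form.

Let `P` be a point-stationary law of rooted configurations of `ℝ³` (Mecke / mass-transport identity
`Literature.Probability.Process.IsPointStationaryLaw`), carried by rooted `δ`-hard-core configurations, and
let `D ⊆ ℝ³` be a separated point set whose class events `C_q = {count|A(D − q) : A}` are measurable.  For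
two roots `a, b` and a radius `r`, testing the Mecke identity with the two-event transport

  `g(μ, y) = 1_{C_a}(μ) · 1_{C_b}(θ_y κμ) · 1{‖y‖ ≤ r}`

(`κ` the s-finite kernel equal to the identity on locally finite configurations,
`Literature.Probability.Process.exists_isSFiniteKernel_apply_eq_self`, which makes `(μ, y) ↦ θ_y κμ`
jointly measurable, `measurable_map_sub_kernel`) gives the DETAILED BALANCE (`fo_balance`)

  `P(C_a) · #{s ∈ Sym(D)·b : dist s a ≤ r} = P(C_b) · #{s ∈ Sym(D)·a : dist s b ≤ r}` :

the mass sent from roots of class `a` to points of class `b` within distance `r` equals the mass received.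
The inner integrals are the counts of helper file B (`fo_lintegral_sent`, `fo_lintegral_received`); the
right-hand side is evaluated `P`-a.e. on rooted hard-core configurations (a configuration outside `C_b`
receives nothing, because rooting back a re-rooted locally finite configuration returns it).
[cite: AldousLyons2007, Thm 3.1 (graph form); LastPenrose2017, Thm 9.4 / §9.3; HevelingLast2005]
-/

noncomputable section

namespace Summit.AtomisticToContinuum.Crystallization.Theorems.IsometryAtomsAtomicLawChargesCrystal

open MeasureTheory Metric Set ProbabilityTheory
open scoped ENNReal

/-- A translate of a `ρ`-separated set is `ρ`-separated. [folklore] -/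
theorem fo_sub_image_separated {S : Set (EuclideanSpace ℝ (Fin 3))} {ρ : ℝ}
    (hS : ∀ x ∈ S, ∀ y ∈ S, x ≠ y → ρ ≤ dist x y) (y : EuclideanSpace ℝ (Fin 3)) :
    ∀ x ∈ (fun z => z - y) '' S, ∀ x' ∈ (fun z => z - y) '' S, x ≠ x' → ρ ≤ dist x x' := by
  rintro _ ⟨x, hx, rfl⟩ _ ⟨x', hx', rfl⟩ hne
  rw [dist_sub_right]
  exact hS x hx x' hx' fun h => hne (by rw [h])

/-- **The s-finite identity kernel on locally finite configurations of `ℝ³`** (norm-shell instance of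
`Literature.Probability.Process.exists_isSFiniteKernel_apply_eq_self`). [folklore] -/
theorem fo_exists_kernel :
    ∃ κ : Kernel (Measure (EuclideanSpace ℝ (Fin 3))) (EuclideanSpace ℝ (Fin 3)), IsSFiniteKernel κ ∧
      ∀ μ : Measure (EuclideanSpace ℝ (Fin 3)),
        (∀ n : ℕ, μ ((fun z : EuclideanSpace ℝ (Fin 3) => ⌊‖z‖⌋₊) ⁻¹' {n}) < ⊤) → κ μ = μ :=
  Literature.Probability.Process.exists_isSFiniteKernel_apply_eq_self
    (fun n : ℕ => (fun z : EuclideanSpace ℝ (Fin 3) => ⌊‖z‖⌋₊) ⁻¹' {n})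
    Literature.Probability.Process.measurableSet_floorNorm_preimage
    (fun _ _ hij => Set.disjoint_iff.2 fun _ hz => hij (hz.1.symm.trans hz.2))
    (fun z => ⟨⌊‖z‖⌋₊, rfl⟩)

/-- **Detailed Mecke balance between two class events.**  For a point-stationary law `P` carried by
rooted `δ`-hard-core configurations (`δ > 0`), a `ρ`-separated `D ⊆ ℝ³` (`ρ > 0`) with measurable class
events, two roots `a, b` and a radius `r`:
`P(C_a) · #{s ∈ D : s ∈ Sym(D)·b, dist s a ≤ r} = P(C_b) · #{s ∈ D : s ∈ Sym(D)·a, dist s b ≤ r}`.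
[cite: AldousLyons2007, Thm 3.1; LastPenrose2017, Thm 9.4] -/
theorem fo_balance {D : Set (EuclideanSpace ℝ (Fin 3))} {ρ : ℝ} (hρ : 0 < ρ)
    (hD : ∀ x ∈ D, ∀ y ∈ D, x ≠ y → ρ ≤ dist x y)
    {P : Measure (Measure (EuclideanSpace ℝ (Fin 3)))}
    (hSt : Literature.Probability.Process.IsPointStationaryLaw P)
    {δ : ℝ} (hδ : 0 < δ) (hHC : ∀ᵐ μ ∂P, Literature.Probability.Process.IsRootedHardCore δ μ)
    (hmeas : ∀ q : EuclideanSpace ℝ (Fin 3), MeasurableSet {μ : Measure (EuclideanSpace ℝ (Fin 3)) |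
      ∃ A : EuclideanSpace ℝ (Fin 3) →ₗᵢ[ℝ] EuclideanSpace ℝ (Fin 3),
        μ = (Measure.count : Measure (EuclideanSpace ℝ (Fin 3))).restrict ((fun t => A (t - q)) '' D)})
    (a b : EuclideanSpace ℝ (Fin 3)) (r : ℝ) :
    P {μ : Measure (EuclideanSpace ℝ (Fin 3)) | ∃ A : EuclideanSpace ℝ (Fin 3) →ₗᵢ[ℝ]
        EuclideanSpace ℝ (Fin 3), μ = (Measure.count : Measure (EuclideanSpace ℝ (Fin 3))).restrict
          ((fun t => A (t - a)) '' D)} *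
      ({s | s ∈ D ∧ (∃ g : EuclideanSpace ℝ (Fin 3) ≃ᵃⁱ[ℝ] EuclideanSpace ℝ (Fin 3),
        g '' D = D ∧ g b = s) ∧ dist s a ≤ r}).encard =
    P {μ : Measure (EuclideanSpace ℝ (Fin 3)) | ∃ A : EuclideanSpace ℝ (Fin 3) →ₗᵢ[ℝ]
        EuclideanSpace ℝ (Fin 3), μ = (Measure.count : Measure (EuclideanSpace ℝ (Fin 3))).restrict
          ((fun t => A (t - b)) '' D)} *
      ({s | s ∈ D ∧ (∃ g : EuclideanSpace ℝ (Fin 3) ≃ᵃⁱ[ℝ] EuclideanSpace ℝ (Fin 3),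
        g '' D = D ∧ g a = s) ∧ dist s b ≤ r}).encard := by
  classical
  -- the two class events
  set Ca : Set (Measure (EuclideanSpace ℝ (Fin 3))) := {μ | ∃ A : EuclideanSpace ℝ (Fin 3) →ₗᵢ[ℝ]
      EuclideanSpace ℝ (Fin 3), μ = (Measure.count : Measure (EuclideanSpace ℝ (Fin 3))).restrict
        ((fun t => A (t - a)) '' D)} with hCa
  set Cb : Set (Measure (EuclideanSpace ℝ (Fin 3))) := {μ | ∃ A : EuclideanSpace ℝ (Fin 3) →ₗᵢ[ℝ]
      EuclideanSpace ℝ (Fin 3), μ = (Measure.count : Measure (EuclideanSpace ℝ (Fin 3))).restrict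
        ((fun t => A (t - b)) '' D)} with hCb
  have hCa_meas : MeasurableSet Ca := hmeas a
  have hCb_meas : MeasurableSet Cb := hmeas b
  -- the kernel device
  obtain ⟨κ, hκsf, hκid⟩ := fo_exists_kernel
  haveI := hκsf
  -- the two-event transport function
  set g : Measure (EuclideanSpace ℝ (Fin 3)) → EuclideanSpace ℝ (Fin 3) → ℝ≥0∞ := fun μ y =>
    Ca.indicator 1 μ * (Cb.indicator 1 ((κ μ).map (fun z => z - y)) *
      (closedBall (0 : EuclideanSpace ℝ (Fin 3)) r).indicator 1 y) with hg_def
  have hg : Measurable (Function.uncurry g) := by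
    have h1 : Measurable fun p : Measure (EuclideanSpace ℝ (Fin 3)) × EuclideanSpace ℝ (Fin 3) =>
        Ca.indicator (1 : Measure (EuclideanSpace ℝ (Fin 3)) → ℝ≥0∞) p.1 :=
      (measurable_one.indicator hCa_meas).comp measurable_fst
    have h2 : Measurable fun p : Measure (EuclideanSpace ℝ (Fin 3)) × EuclideanSpace ℝ (Fin 3) =>
        Cb.indicator (1 : Measure (EuclideanSpace ℝ (Fin 3)) → ℝ≥0∞) ((κ p.1).map (fun z => z - p.2)) :=
      (measurable_one.indicator hCb_meas).comp
        (Literature.Probability.Process.measurable_map_sub_kernel κ)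
    have h3 : Measurable fun p : Measure (EuclideanSpace ℝ (Fin 3)) × EuclideanSpace ℝ (Fin 3) =>
        (closedBall (0 : EuclideanSpace ℝ (Fin 3)) r).indicator (1 : EuclideanSpace ℝ (Fin 3) → ℝ≥0∞) p.2 :=
      (measurable_one.indicator measurableSet_closedBall).comp measurable_snd
    exact h1.mul (h2.mul h3)
  have hM := hSt g hg
  -- LEFT-HAND SIDE: mass sent from roots of class `a` (exact evaluation, no a.e. needed)
  have hL : ∫⁻ μ, ∫⁻ y, g μ y ∂μ ∂P =
      ({s | s ∈ D ∧ (∃ g : EuclideanSpace ℝ (Fin 3) ≃ᵃⁱ[ℝ] EuclideanSpace ℝ (Fin 3),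
        g '' D = D ∧ g b = s) ∧ dist s a ≤ r}).encard * P Ca := by
    have hfun : (fun μ => ∫⁻ y, g μ y ∂μ) = Ca.indicator (fun _ =>
        (({s | s ∈ D ∧ (∃ g : EuclideanSpace ℝ (Fin 3) ≃ᵃⁱ[ℝ] EuclideanSpace ℝ (Fin 3),
          g '' D = D ∧ g b = s) ∧ dist s a ≤ r}).encard : ℝ≥0∞)) := by
      funext μ
      by_cases hμ : μ ∈ Ca
      · rw [indicator_of_mem hμ]
        obtain ⟨A, rfl⟩ := hμ
        have hmem : (Measure.count : Measure (EuclideanSpace ℝ (Fin 3))).restrict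
            ((fun t => A (t - a)) '' D) ∈ Ca := ⟨A, rfl⟩
        simp only [hg_def, indicator_of_mem hmem, Pi.one_apply, one_mul]
        rw [hκid _ (fo_rootedCopy_shell_lt_top hρ hD A a)]
        exact fo_lintegral_sent hρ hD A a b r
      · rw [indicator_of_notMem hμ]
        simp only [hg_def, indicator_of_notMem hμ, zero_mul, lintegral_zero]
    rw [hfun, lintegral_indicator_const hCa_meas]
  -- RIGHT-HAND SIDE: mass received at roots of class `b` (evaluated a.e. on hard-core configurations)
  have hR : ∫⁻ μ, ∫⁻ y, g (μ.map (fun z => z - y)) (-y) ∂μ ∂P =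
      ({s | s ∈ D ∧ (∃ g : EuclideanSpace ℝ (Fin 3) ≃ᵃⁱ[ℝ] EuclideanSpace ℝ (Fin 3),
        g '' D = D ∧ g a = s) ∧ dist s b ≤ r}).encard * P Cb := by
    have hae : (fun μ => ∫⁻ y, g (μ.map (fun z => z - y)) (-y) ∂μ) =ᵐ[P] Cb.indicator (fun _ =>
        (({s | s ∈ D ∧ (∃ g : EuclideanSpace ℝ (Fin 3) ≃ᵃⁱ[ℝ] EuclideanSpace ℝ (Fin 3),
          g '' D = D ∧ g a = s) ∧ dist s b ≤ r}).encard : ℝ≥0∞)) := by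
      filter_upwards [hHC] with μ hμ
      by_cases hb : μ ∈ Cb
      · rw [indicator_of_mem hb]
        obtain ⟨A, rfl⟩ := hb
        simp only [hg_def]
        exact fo_lintegral_received hρ hD κ hκid A a b r
      · rw [indicator_of_notMem hb]
        -- nothing is received: rooting back a re-rooted hard-core configuration returns `μ ∉ C_b`
        obtain ⟨S, -, hsep, rfl⟩ := hμ
        have hcount : S.Countable := fo_countable_of_separated hδ hsep
        rw [lintegral_countable _ hcount]
        simp only [Measure.count_singleton, mul_one]
        refine ENNReal.tsum_eq_zero.2 fun y => ?_
        have hlf : ∀ n : ℕ, ((Measure.count : Measure (EuclideanSpace ℝ (Fin 3))).restrict S).map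
            (fun z => z - (y : EuclideanSpace ℝ (Fin 3)))
              ((fun z : EuclideanSpace ℝ (Fin 3) => ⌊‖z‖⌋₊) ⁻¹' {n}) < ⊤ := by
          intro n
          rw [Literature.Probability.Process.map_sub_count_restrict]
          exact fo_count_restrict_shell_lt_top hδ (fo_sub_image_separated hsep _) n
        simp only [hg_def]
        rw [hκid _ hlf, fo_map_sub_map_sub_neg, indicator_of_notMem hb]
        simp
    rw [lintegral_congr_ae hae, lintegral_indicator_const hCb_meas]
  -- combine
  rw [hL, hR] at hM
  rw [mul_comm (P Ca), mul_comm (P Cb)]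
  exact hM

/-- **Registered sub-goal C of stub `stub_finiteOrbitsOfChargedClass`** (binder-free packaging of the
detailed balance `fo_balance` for the ledger's stub registry). [cite: AldousLyons2007, Thm 3.1] -/
theorem fo_subgoalC_balance : ∀ (D : Set (EuclideanSpace ℝ (Fin 3))) (ρ : ℝ), 0 < ρ → (∀ x ∈ D, ∀ y ∈ D, x ≠ y → ρ ≤ dist x y) → ∀ (P : MeasureTheory.Measure (MeasureTheory.Measure (EuclideanSpace ℝ (Fin 3)))), Literature.Probability.Process.IsPointStationaryLaw P → ∀ (δ : ℝ), 0 < δ → (∀ᵐ μ ∂P, Literature.Probability.Process.IsRootedHardCore δ μ) → (∀ q : EuclideanSpace ℝ (Fin 3), MeasurableSet {μ : MeasureTheory.Measure (EuclideanSpace ℝ (Fin 3)) | ∃ A : EuclideanSpace ℝ (Fin 3) →ₗᵢ[ℝ] EuclideanSpace ℝ (Fin 3), μ = (MeasureTheory.Measure.count : MeasureTheory.Measure (EuclideanSpace ℝ (Fin 3))).restrict ((fun t => A (t - q)) '' D)}) → ∀ (a b : EuclideanSpace ℝ (Fin 3)) (r : ℝ), P {μ : MeasureTheory.Measure (EuclideanSpace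 ℝ (Fin 3)) | ∃ A : EuclideanSpace ℝ (Fin 3) →ₗᵢ[ℝ] EuclideanSpace ℝ (Fin 3), μ = (MeasureTheory.Measure.count : MeasureTheory.Measure (EuclideanSpace ℝ (Fin 3))).restrict ((fun t => A (t - a)) '' D)} * ({s | s ∈ D ∧ (∃ g : EuclideanSpace ℝ (Fin 3) ≃ᵃⁱ[ℝ] EuclideanSpace ℝ (Fin 3), g '' D = D ∧ g b = s) ∧ dist s a ≤ r}).encard = P {μ : MeasureTheory.Measure (EuclideanSpace ℝ (Fin 3)) | ∃ A : EuclideanSpace ℝ (Fin 3) →ₗᵢ[ℝ] EuclideanSpace ℝ (Fin 3), μ = (MeasureTheory.Measure.count : MeasureTheory.Measure (EuclideanSpace ℝ (Fin 3))).restrict ((fun t => A (t - b)) '' D)} * ({s | s ∈ D ∧ (∃ g : EuclideanSpace ℝ (Fin 3) ≃ᵃⁱ[ℝ] EuclideanSpace ℝ (Fin 3), g '' D = D ∧ g a = s) ∧ dist s b ≤ r}).encard :=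
  fun _ _ hρ hD _ hSt _ hδ hHC hmeas a b r => fo_balance hρ hD hSt hδ hHC hmeas a b r

end Summit.AtomisticToContinuum.Crystallization.Theorems.IsometryAtomsAtomicLawChargesCrystal

end
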